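import Summits.QuantumFields.YangMills.Theorems.FluctuationComparisonRegPrIntLPolymerAnalyticKnit
import Literature.MathematicalPhysics.QuantumFieldTheory.Balaban1983to89.TreeLengthTorusGeometry
import Literature.Probability.LatticeModels.PolymerGasRatio
import Summits.QuantumFields.YangMills.Theorems.FluctuationComparisonRegPrIntLPolymerAnalyticAdd
import Summits.QuantumFields.YangMills.Theorems.FluctuationComparisonRegPrIntLPolymerMayerGas
import HarnessLib

/-!
# (F) POLY-GAS-KNIT: ⟨BAL-GAS∘⟩ → ⟨POLYᵃ∘⟩ THROUGH THE LAST MAYER STEP (E) — the polymer-GAS letter behind LINE g24-3's analytic edition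
# (crux `FluctuationComparisonRegPrIntL`, stmt-QuantumFields-20520; chain of record ★★OWNER RECORD 17ch: ⟨POLYᵃ∘⟩ → ⟨POLYᵗ∘⟩ → ⟨POLYⁿ∘⟩ → ⟨POLY∘ v2⟩ → ⟨S2β⟩)

Cell `ym3-torus` (YM ladder rung R3 = continuum `SU(2)` Yang–Mills on the three-torus — a RUNG, NOT d = 4, NOT infinite volume, NOT a mass gap, NOT Clay).  Width seat
`ym-ust-20520-w4` (gen 19); `--supports stmt-QuantumFields-20520 --as helper`, count-neutral, definition-free, default heartbeats.

WHAT.  POLYᵃ∘ (the binder of LEAD w3-20520 g20's ✓p773327 `…PolymerAnalyticKnit.polymerTreeCan_of_polymerAnalytic`, VERBATIM) asks on every window for a LOCALIZED SUM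
`log ρ + β_K·𝔄^reg = c₀ + Σ_Y T Y` with local, face-connected-supported terms admitting bounded analytic one-bond interpolations.  Print produces such a sum in TWO
moves: (1) the small-field∕large-field expansions write the density's fluctuation part as a HARD-CORE POLYMER GAS `Ξ(U)` over the torus localization domains with LOCAL,
(2.38)-BOUNDED, ANALYTIC activities ([Balaban1987RG1] (0.24)–(0.25), [Balaban1989LargeFieldII] (1.98)–(1.100); [Balaban1988RG2Cluster] (2.11)) — the letter **BAL-GAS∘** below;
(2) the LAST MAYER STEP `log Ξ(U) = Σ_Y E(Y)(U)` with (2.41)-bounded, analytic, local, connected-supported terms ([Balaban1988RG2Cluster] (2.12)–(2.13), (2.39)–(2.41);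
[KoteckyPreiss1986]) — LEAD w3-20520 g20's (E) `…PolymerMayerGas.exists_localized_log_gas` (abstract over configurations; its statement is the HYPOTHESIS `hE` of the first theorem, universally quantified, and is DISCHARGED by name in the second).
* BAL-GAS∘ (LEAD w3-20520 g20's 13:04:54Z RE-LETTER, TWO displayed families — print's window density is `exp(−β𝔄 + Σ_X E(X) + Σ_X R′(X)) × Ξ_strata`): POLYᵃ∘'s frame
  VERBATIM up to the window-version quantifiers, with (a) the constants block `∃ (A Bs Rdec : ℝ) (R : ℕ → ℝ), 0 ≤ A ∧ 0 ≤ Bs ∧ κ + 2·κ₀(4·2³,2·3) + 2 ≤ Rdec ∧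
  A·e^{5κ+1}·K₀(4·2³,2·3)·(2·3+1)·(4·2³) ≤ 1 ∧ (∀ J, 1 < R J) ∧ superpoly(R⁻¹)` (the regime of (E) at `r₁ := κ` on `tgeometry 3 N`; constants = ✓`tgeometry_consts`) and (b) the
  conclusion `∃ N e, isometry ∧ ∃ c₀ Sm act, [Sm: POLYᵃ∘'s (i)(ii)(iii) VERBATIM-shaped at `Bs`, rate `κ`, radii `R J` — the LOCALIZED ANALYTIC SUM of the small-field terms
  (0.23)–(0.25) and the `R′`-terms (1.98)–(1.100)] ∧ [act: (L) locality through the source cubes ∧ (B) window bound `|act Z U| ≤ A·e^{−Rdec·d(Z)}` ∧ (AN) analytic one-bond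
  interpolations `k Z` on `ball 0 (R J)` with the same majorant — the GAS of the most recent large-field strata] ∧ (REP) `0 < Ξ(U)` and
  `log ρ U + β_K·𝔄^reg U = c₀ + Σ_Y Sm Y U + log Ξ(U)` on the window`.
* ★★★ `polymerAnalyticCan_of_balabanGas_of_mayer (hE : ⟨(E) statement, ∀ N ι G q S ρ A R r₁ Rad⟩) (hG : ⟨BAL-GAS∘⟩) : ⟨POLYᵃ∘ VERBATIM⟩` — `T := Sm + T_gas` with `T_gas` (E)'s
  terms at `ι := PBond (F.P J) 0`, `G := SU(2)`, `q b := tcubeOf N M (e b.src)`, `S := {PlaqSmall θ_J}`, `r₁ := κ`, added by LEAD's (G) ✓`…PolymerAnalyticAdd.localizedAnalytic_add`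
  at the profile `m Y := e^{−κ d(Y)}`; `B := Bs + e·7·32·K₀(32,6)²·A`.

* ★★★ `polymerAnalyticCan_of_balabanGas (hG) : ⟨POLYᵃ∘⟩` — the same with `hE` discharged by ✓(E) `exists_localized_log_gas`.

NET: ⟨BAL-GAS∘⟩ → ⟨POLYᵃ∘⟩ → … → ⟨S2β :412⟩ in `Theorems/` — the cone's single letter becomes BAL-GAS∘ («Bałaban's effective density on the window IS such a gas»:
the (b) dictionary, (d) torons and ALL activity estimates of the ideator's distance-to-print map; the Mayer step (a), the Schwarz step (c) and (1.26) being kernel theorems).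

HONEST SCOPE.  A knit; BAL-GAS∘ and (E) are HYPOTHESES here; nothing of Bałaban's expansions, POLYᵃ∘, S2β, the five ∘-stubs or `FluctuationComparisonRegPrIntL` (20520) is proved;
registry v11.4 0∕5 UNCHANGED; no summit is proved by a helper; rung R3 = SU(2) YM₃ on T³ — NOT d = 4, NOT infinite volume, NOT a mass gap, NOT Clay.  Sorry-free, axioms standard.

References: T. Bałaban, CMP **109** (1987) 249–301 [Balaban1987RG1] (Thm 1 p.259, (0.24)–(0.25) p.257, (1.11)–(1.14) p.262); T. Bałaban, CMP **122** (1989) 355–392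
[Balaban1989LargeFieldII] ((1.98)–(1.100) p.390); T. Bałaban, CMP **116** (1988) 1–22 [Balaban1988RG2Cluster] ((2.11)–(2.13) p.14, (2.38)–(2.41) pp.20–21, (1.26) p.8);
R. Kotecký, D. Preiss, CMP **103** (1986) 491–498 [KoteckyPreiss1986].
-/

set_option autoImplicit false

noncomputable section

namespace Summit.QuantumFields.YangMills.Theorems.FluctuationComparisonRegPrIntLPolymerGasKnit

open MeasureTheory Filter Topology Set
open scoped BigOperators
open Literature.MathematicalPhysics.QuantumFieldTheory.Balaban1983to89
open Literature.MathematicalPhysics.QuantumFieldTheory.Balaban1983to89.T3ContinuumYM3Torus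
open Literature.MathematicalPhysics.QuantumFieldTheory.Balaban1983to89.T3NestedUnitLaws
open Literature.MathematicalPhysics.QuantumFieldTheory.Balaban1983to89.T3UnitLawDensityEML
open Literature.MathematicalPhysics.QuantumFieldTheory.Balaban1983to89.T3UnitScaleTilt
open Literature.MathematicalPhysics.QuantumFieldTheory.Balaban1983to89.T3TiltDescent
open Literature.MathematicalPhysics.QuantumFieldTheory.Balaban1983to89.T3PrintedRegularMinimiser
open Literature.MathematicalPhysics.QuantumFieldTheory.Balaban1983to89.T3LevelShift
open Literature.MathematicalPhysics.QuantumFieldTheory.Balaban1983to89.Missing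
open Literature.MathematicalPhysics.QuantumFieldTheory.Balaban1983to89.T4Continuum
open Literature.MathematicalPhysics.QuantumFieldTheory.Balaban1983to89.TreeLengthTorus (TPt TDom tsys TFaceConnected torusTreeLen)
open Literature.MathematicalPhysics.QuantumFieldTheory.Balaban1983to89.TreeLengthTorusGeometry (TTouch tgeometry)
open Literature.MathematicalPhysics.QuantumFieldTheory.Balaban1983to89.B12TreeDecay (kappa₀ K₀)
open Literature.MathematicalPhysics.QuantumFieldTheory.Balaban1983to89.B12Decay510Torus (pl1 tcubeOf)
open Literature.Probability.LatticeModels (polymerPartitionFunction)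
open Summit.QuantumFields.YangMills.Theorems.FluctuationComparisonRegPrIntLPolymerAnalyticAdd (localizedAnalytic_add sum_add_pointwise)

open Classical in
/-- ★★★ **(F) ⟨BAL-GAS∘⟩ → ⟨POLYᵃ∘⟩ THROUGH THE LAST MAYER STEP.**  Hypotheses: `hE` = the statement of LEAD w3-20520 g20's (E) `exists_localized_log_gas` (v1.3 ef20630e as filed ⧗p774966 — clause (iii) in POLYᵃ∘'s `exp(−r₁·d)` currency), universally quantified over `N ι G q S ρ A R r₁ Rad` — discharged by that theorem once it lands; `hG` = BAL-GAS∘ (two families; text in the module docstring).  Conclusion: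
POLYᵃ∘ VERBATIM (= the `hA` binder of ✓`…PolymerAnalyticKnit.polymerTreeCan_of_polymerAnalytic`), with `B := Bs + e·(2·3+1)·(4·2³)·K₀(4·2³,2·3)²·A`, the same radii `R J`, the same
`κ`, `c₀` from (REP), and `T := Sm + T_gas`, `T_gas` := (E)'s terms at `ι := PBond (F.P J) 0`, `G := SU(2)`, `q b := tcubeOf N M (e b.src)`, `S :=` the `θ_J`-window, `r₁ := κ`.
[cite: Balaban1988RG2Cluster, (2.11)-(2.13) p.14 and (2.38)-(2.41) pp.20-21; Balaban1987RG1, (0.23)-(0.25) p.257; Balaban1989LargeFieldII, (1.98)-(1.100) p.390] -/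
theorem polymerAnalyticCan_of_balabanGas_of_mayer
    (hE : ∀ (N : ℕ) [NeZero N] (ι G : Type) (q : ι → TPt 3 N) (S : Set (ι → G))
      (ρ : TDom 3 N → (ι → G) → ℝ) (A R r₁ Rad : ℝ), 0 ≤ A → 0 ≤ r₁ →
      r₁ + 2 * (tgeometry 3 N).κ₀ + 2 ≤ R →
      A * Real.exp (5 * r₁ + 1) * (tgeometry 3 N).K₀ * (tgeometry 3 N).ν * (tgeometry 3 N).c₁ ≤ 1 →
      (∀ Z, ∀ U ∈ S, |ρ Z U| ≤ A * Real.exp (-(R * torusTreeLen Z.1))) →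
      (∀ Z U V, (∀ i, q i ∈ Z.1 → U i = V i) → ρ Z U = ρ Z V) →
      (∀ (i : ι) (U V : ι → G), U ∈ S → V ∈ S → (∀ j, j ≠ i → U j = V j) →
        ∃ k : TDom 3 N → ℂ → ℂ, (∀ Z, DifferentiableOn ℂ (k Z) (Metric.ball 0 Rad)) ∧
          (∀ Z, ∀ z ∈ Metric.ball (0 : ℂ) Rad, ‖k Z z‖ ≤ A * Real.exp (-(R * torusTreeLen Z.1))) ∧
          (∀ Z, k Z 0 = (ρ Z U : ℂ)) ∧ (∀ Z, k Z 1 = (ρ Z V : ℂ))) →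
      ∃ T : Finset (TPt 3 N) → (ι → G) → ℝ,
        (∀ Y U V, (∀ i, q i ∈ Y → U i = V i) → T Y U = T Y V) ∧
        (∀ Y, ¬ TFaceConnected Y → ∀ U, T Y U = 0) ∧
        (∀ (i : ι) (U V : ι → G), U ∈ S → V ∈ S → (∀ j, j ≠ i → U j = V j) → ∀ Y : Finset (TPt 3 N),
          ∃ g : ℂ → ℂ, DifferentiableOn ℂ g (Metric.ball 0 Rad) ∧
            (∀ z ∈ Metric.ball (0 : ℂ) Rad, ‖g z‖ ≤
              Real.exp 1 * (tgeometry 3 N).ν * (tgeometry 3 N).c₁ * (tgeometry 3 N).K₀ ^ 2 * A * Real.exp (-r₁ * torusTreeLen Y)) ∧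
            g 0 = (T Y U : ℂ) ∧ g 1 = (T Y V : ℂ)) ∧
        (∀ U ∈ S, 0 < (polymerPartitionFunction TTouch (fun Z : TDom 3 N => (ρ Z U : ℂ)) Finset.univ).re ∧
          Real.log (polymerPartitionFunction TTouch (fun Z : TDom 3 N => (ρ Z U : ℂ)) Finset.univ).re = ∑ Y : Finset (TPt 3 N), T Y U))
    (hG : ∀ (L : ℕ), ∃ pS : ℝ, ∀ (b₀ p₀ : ℝ), 0 < b₀ → pS ≤ p₀ → 0 < p₀ → ∃ ε₁ : ℝ, 0 < ε₁ ∧ ∀ (ε₀ : ℝ), 0 < ε₀ → ε₀ ≤ ε₁ →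
      ∃ γ₁ : ℝ, 0 < γ₁ ∧ ∃ (M : ℕ) (_ : NeZero M), ∃ κ : ℝ, 0 < κ ∧ 2 * kappa₀ (4 * 2 ^ 3) (2 * 3) ≤ κ ∧
        ∀ (F : T3Family) (γ : ℝ), F.L = L → 0 < γ → γ ≤ γ₁ →
        ∃ (A Bs Rdec : ℝ) (R : ℕ → ℝ), 0 ≤ A ∧ 0 ≤ Bs ∧ κ + 2 * kappa₀ (4 * 2 ^ 3) (2 * 3) + 2 ≤ Rdec ∧
          A * Real.exp (5 * κ + 1) * K₀ (4 * 2 ^ 3) (2 * 3) * (2 * (3 : ℝ) + 1) * (4 * 2 ^ 3) ≤ 1 ∧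
          (∀ J, 1 < R J) ∧ (∀ a : ℕ, Tendsto (fun J : ℕ => ((J : ℝ) + 1) ^ a * (R J)⁻¹) atTop (𝓝 0)) ∧
          ∀ (ν : ℕ → (j : ℕ) → Measure (GaugeField (F.P j) 0 (Matrix.specialUnitaryGroup (Fin 2) ℂ))),
            (∀ K, ν K K = T4GenFunBounds.gibbsMeasure (F.P K) ((F.scheme ℰp γ).β K)) →
            (∀ K j, j < K → ν K j = Measure.map (descend F ℰp j) (ν K (j + 1))) →
            ∀ (J K : ℕ) (hJK : J ≤ K) (ρ : GaugeField (F.P J) 0 (Matrix.specialUnitaryGroup (Fin 2) ℂ) → ℝ),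
              (∀ U, PlaqSmall (θBal F.L γ b₀ p₀ J) U → 0 < ρ U) →
              ν K J = (fieldMeasure _ _ _).withDensity (fun U => ENNReal.ofReal (ρ U)) →
              ContinuousOn ρ {U | PlaqSmall (θBal F.L γ b₀ p₀ J) U} →
              ∃ (N : ℕ) (_ : NeZero N) (e : Site (F.P J) 0 ≃ TPt 3 (N * M)),
                (∀ x y : Site (F.P J) 0, (x.tdist y : ℝ) = pl1 (e x - e y)) ∧
                ∃ (c₀ : ℝ) (Sm : Finset (TPt 3 N) → GaugeField (F.P J) 0 (Matrix.specialUnitaryGroup (Fin 2) ℂ) → ℝ) (act : TDom 3 N → GaugeField (F.P J) 0 (Matrix.specialUnitaryGroup (Fin 2) ℂ) → ℝ),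
                  (∀ (Y : Finset (TPt 3 N)) (U V : GaugeField (F.P J) 0 (Matrix.specialUnitaryGroup (Fin 2) ℂ)),
                      (∀ b : PBond (F.P J) 0, tcubeOf N M (e b.src) ∈ Y → U b = V b) → Sm Y U = Sm Y V) ∧
                  (∀ Y : Finset (TPt 3 N), ¬ TFaceConnected Y → ∀ U : GaugeField (F.P J) 0 (Matrix.specialUnitaryGroup (Fin 2) ℂ), Sm Y U = 0) ∧
                  (∀ (b : PBond (F.P J) 0) (U V : GaugeField (F.P J) 0 (Matrix.specialUnitaryGroup (Fin 2) ℂ)),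
                      PlaqSmall (θBal F.L γ b₀ p₀ J) U → PlaqSmall (θBal F.L γ b₀ p₀ J) V → (∀ e', e' ≠ b → U e' = V e') → ∀ Y : Finset (TPt 3 N),
                      ∃ g : ℂ → ℂ, DifferentiableOn ℂ g (Metric.ball 0 (R J)) ∧
                        (∀ z ∈ Metric.ball (0 : ℂ) (R J), ‖g z‖ ≤ Bs * Real.exp (-κ * torusTreeLen Y)) ∧
                        g 0 = (Sm Y U : ℂ) ∧ g 1 = (Sm Y V : ℂ)) ∧
                  (∀ (Z : TDom 3 N) (U V : GaugeField (F.P J) 0 (Matrix.specialUnitaryGroup (Fin 2) ℂ)),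
                      (∀ b : PBond (F.P J) 0, tcubeOf N M (e b.src) ∈ Z.1 → U b = V b) → act Z U = act Z V) ∧
                  (∀ (Z : TDom 3 N) (U : GaugeField (F.P J) 0 (Matrix.specialUnitaryGroup (Fin 2) ℂ)), PlaqSmall (θBal F.L γ b₀ p₀ J) U →
                      |act Z U| ≤ A * Real.exp (-(Rdec * torusTreeLen Z.1))) ∧
                  (∀ (b : PBond (F.P J) 0) (U V : GaugeField (F.P J) 0 (Matrix.specialUnitaryGroup (Fin 2) ℂ)),
                      PlaqSmall (θBal F.L γ b₀ p₀ J) U → PlaqSmall (θBal F.L γ b₀ p₀ J) V → (∀ e', e' ≠ b → U e' = V e') →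
                      ∃ k : TDom 3 N → ℂ → ℂ, (∀ Z, DifferentiableOn ℂ (k Z) (Metric.ball 0 (R J))) ∧
                        (∀ Z, ∀ z ∈ Metric.ball (0 : ℂ) (R J), ‖k Z z‖ ≤ A * Real.exp (-(Rdec * torusTreeLen Z.1))) ∧
                        (∀ Z, k Z 0 = (act Z U : ℂ)) ∧ (∀ Z, k Z 1 = (act Z V : ℂ))) ∧
                  (∀ U : GaugeField (F.P J) 0 (Matrix.specialUnitaryGroup (Fin 2) ℂ), PlaqSmall (θBal F.L γ b₀ p₀ J) U →
                      0 < (polymerPartitionFunction TTouch (fun Z : TDom 3 N => (act Z U : ℂ)) Finset.univ).re ∧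
                      Real.log (ρ U) + (F.scheme ℰp γ).β K * minActionRegPr F J K hJK ε₀ U =
                        c₀ + (∑ Y : Finset (TPt 3 N), Sm Y U) +
                          Real.log (polymerPartitionFunction TTouch (fun Z : TDom 3 N => (act Z U : ℂ)) Finset.univ).re)) :
    ∀ (L : ℕ), ∃ pS : ℝ, ∀ (b₀ p₀ : ℝ), 0 < b₀ → pS ≤ p₀ → 0 < p₀ → ∃ ε₁ : ℝ, 0 < ε₁ ∧ ∀ (ε₀ : ℝ), 0 < ε₀ → ε₀ ≤ ε₁ →
      ∃ γ₁ : ℝ, 0 < γ₁ ∧ ∃ (M : ℕ) (_ : NeZero M), ∃ κ : ℝ, 0 < κ ∧ 2 * kappa₀ (4 * 2 ^ 3) (2 * 3) ≤ κ ∧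
        ∀ (F : T3Family) (γ : ℝ), F.L = L → 0 < γ → γ ≤ γ₁ →
        ∃ (B : ℝ) (R : ℕ → ℝ), 0 ≤ B ∧ (∀ J, 1 < R J) ∧ (∀ a : ℕ, Tendsto (fun J : ℕ => ((J : ℝ) + 1) ^ a * (R J)⁻¹) atTop (𝓝 0)) ∧
          ∀ (ν : ℕ → (j : ℕ) → Measure (GaugeField (F.P j) 0 (Matrix.specialUnitaryGroup (Fin 2) ℂ))),
            (∀ K, ν K K = T4GenFunBounds.gibbsMeasure (F.P K) ((F.scheme ℰp γ).β K)) →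
            (∀ K j, j < K → ν K j = Measure.map (descend F ℰp j) (ν K (j + 1))) →
            ∀ (J K : ℕ) (hJK : J ≤ K) (ρ : GaugeField (F.P J) 0 (Matrix.specialUnitaryGroup (Fin 2) ℂ) → ℝ),
              (∀ U, PlaqSmall (θBal F.L γ b₀ p₀ J) U → 0 < ρ U) →
              ν K J = (fieldMeasure _ _ _).withDensity (fun U => ENNReal.ofReal (ρ U)) →
              ContinuousOn ρ {U | PlaqSmall (θBal F.L γ b₀ p₀ J) U} →
              ∃ (N : ℕ) (_ : NeZero N) (e : Site (F.P J) 0 ≃ TPt 3 (N * M)),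
                (∀ x y : Site (F.P J) 0, (x.tdist y : ℝ) = pl1 (e x - e y)) ∧
                ∃ (c₀ : ℝ) (T : Finset (TPt 3 N) → GaugeField (F.P J) 0 (Matrix.specialUnitaryGroup (Fin 2) ℂ) → ℝ),
                  (∀ (Y : Finset (TPt 3 N)) (U V : GaugeField (F.P J) 0 (Matrix.specialUnitaryGroup (Fin 2) ℂ)),
                      (∀ b : PBond (F.P J) 0, tcubeOf N M (e b.src) ∈ Y → U b = V b) → T Y U = T Y V) ∧
                  (∀ Y : Finset (TPt 3 N), ¬ TFaceConnected Y → ∀ U : GaugeField (F.P J) 0 (Matrix.specialUnitaryGroup (Fin 2) ℂ), T Y U = 0) ∧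
                  (∀ (Y : Finset (TPt 3 N)) (b : PBond (F.P J) 0) (U V : GaugeField (F.P J) 0 (Matrix.specialUnitaryGroup (Fin 2) ℂ)),
                      PlaqSmall (θBal F.L γ b₀ p₀ J) U → PlaqSmall (θBal F.L γ b₀ p₀ J) V → (∀ e, e ≠ b → U e = V e) →
                      ∃ g : ℂ → ℂ, DifferentiableOn ℂ g (Metric.ball 0 (R J)) ∧
                        (∀ z ∈ Metric.ball (0 : ℂ) (R J), ‖g z‖ ≤ B * Real.exp (-κ * torusTreeLen Y)) ∧
                        g 0 = (T Y U : ℂ) ∧ g 1 = (T Y V : ℂ)) ∧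
                  (∀ U : GaugeField (F.P J) 0 (Matrix.specialUnitaryGroup (Fin 2) ℂ), PlaqSmall (θBal F.L γ b₀ p₀ J) U →
                      Real.log (ρ U) + (F.scheme ℰp γ).β K * minActionRegPr F J K hJK ε₀ U = c₀ + ∑ Y, T Y U) := by
  intro L
  obtain ⟨pS, HG⟩ := hG L
  refine ⟨pS, fun b₀ p₀ hb hpS hp => ?_⟩
  obtain ⟨ε₁, hε₁, HG⟩ := HG b₀ p₀ hb hpS hp
  refine ⟨ε₁, hε₁, fun ε₀ hε₀ hε₀le => ?_⟩
  obtain ⟨γ₁, hγ₁, M, hM, κ, hκ, hκ₀, HG⟩ := HG ε₀ hε₀ hε₀le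
  refine ⟨γ₁, hγ₁, M, hM, κ, hκ, hκ₀, fun F γ hFL hγ hγle => ?_⟩
  obtain ⟨A, Bs, Rdec, R, hA, hBs, hrate, hsmall, hR1, hRsup, HG⟩ := HG F γ hFL hγ hγle
  refine ⟨Bs + Real.exp 1 * (2 * (3 : ℝ) + 1) * (4 * 2 ^ 3) * K₀ (4 * 2 ^ 3) (2 * 3) ^ 2 * A, R, by positivity, hR1, hRsup,
    fun ν hνK hνj J K hJK ρ hρpos hνJ hρcont => ?_⟩
  obtain ⟨N, hN, e, he, c₀, Sm, act, hSloc, hSsupp, hSan, hL, hB, hAN, hREP⟩ := HG ν hνK hνj J K hJK ρ hρpos hνJ hρcont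
  haveI : NeZero N := hN
  -- the last Mayer step (E) on the gas `act`: `ι := PBond (F.P J) 0`, `G := SU(2)`, `q b := tcubeOf N M (e b.src)`, `S := the θ_J-window`, `r₁ := κ`, `Rad := R J`
  obtain ⟨Tg, hTi, hTii, hTiii, hTiv⟩ := hE N (PBond (F.P J) 0) (Matrix.specialUnitaryGroup (Fin 2) ℂ)
    (fun b => tcubeOf N M (e b.src)) {U | PlaqSmall (θBal F.L γ b₀ p₀ J) U} act A Rdec κ (R J) hA hκ.le
    (by exact hrate) (by exact hsmall)
    (fun Z U hU => hB Z U hU) (fun Z U V hUV => hL Z U V hUV)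
    (fun b U V hU hV hUV => hAN b U V hU hV hUV)
  -- (E)'s bound in POLYᵃ∘'s currency `B_gas * exp(−κ d)` (constants by `tgeometry_consts`, `rfl` for d = 3 after `Nat.cast` normalisation)
  have hconsts := TreeLengthTorusGeometry.tgeometry_consts 3 N
  have hTiii' : ∀ (i : PBond (F.P J) 0) (U V : PBond (F.P J) 0 → (Matrix.specialUnitaryGroup (Fin 2) ℂ)),
      U ∈ {U : GaugeField (F.P J) 0 (Matrix.specialUnitaryGroup (Fin 2) ℂ) | PlaqSmall (θBal F.L γ b₀ p₀ J) U} → V ∈ {U : GaugeField (F.P J) 0 (Matrix.specialUnitaryGroup (Fin 2) ℂ) | PlaqSmall (θBal F.L γ b₀ p₀ J) U} → (∀ j, j ≠ i → U j = V j) →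
      ∀ Y : Finset (TPt 3 N), ∃ g : ℂ → ℂ, DifferentiableOn ℂ g (Metric.ball 0 (R J)) ∧
        (∀ z ∈ Metric.ball (0 : ℂ) (R J), ‖g z‖ ≤ (Real.exp 1 * (2 * (3 : ℝ) + 1) * (4 * 2 ^ 3) * K₀ (4 * 2 ^ 3) (2 * 3) ^ 2 * A) * Real.exp (-κ * torusTreeLen Y)) ∧
        g 0 = (Tg Y U : ℂ) ∧ g 1 = (Tg Y V : ℂ) := by
    intro i U V hU hV hUV Y
    obtain ⟨g, hg, hgB, hg0, hg1⟩ := hTiii i U V hU hV hUV Y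
    refine ⟨g, hg, fun z hz => ?_, hg0, hg1⟩
    have h := hgB z hz
    rw [hconsts.1, hconsts.2.2.1, hconsts.2.2.2, Nat.cast_ofNat] at h
    linarith [h]
  -- the additive closure of POLYᵃ∘-families ((G) ✓`localizedAnalytic_add`) at the profile `m Y := exp(−κ d(Y))`
  obtain ⟨hi, hii, hiii⟩ := localizedAnalytic_add (d := 3) (N := N) (fun b : PBond (F.P J) 0 => tcubeOf N M (e b.src))
    {U : GaugeField (F.P J) 0 (Matrix.specialUnitaryGroup (Fin 2) ℂ) | PlaqSmall (θBal F.L γ b₀ p₀ J) U} (fun Y => Real.exp (-κ * torusTreeLen Y)) Sm Tg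
    hSloc hTi hSsupp hTii (fun i U V hU hV hUV Y => hSan i U V hU hV hUV Y) hTiii'
  refine ⟨N, hN, e, he, c₀, fun Y U => Sm Y U + Tg Y U, fun Y U V hUV => hi Y U V hUV, fun Y hY U => hii Y hY U,
    fun Y b U V hU hV hUV => hiii b U V hU hV hUV Y, fun U hU => ?_⟩
  -- (iv): (REP) + (E)'s `log Ξ = Σ T_gas` + pointwise addition of the sums
  obtain ⟨hΞpos, hrep⟩ := hREP U hU
  obtain ⟨-, hlog⟩ := hTiv U hU
  rw [hrep, hlog, sum_add_pointwise]
  ring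

open Classical in
/-- ★★★ **(F) ⟨BAL-GAS∘⟩ → ⟨POLYᵃ∘⟩, `hE` DISCHARGED BY NAME** by LEAD w3-20520 g20's ✓(E) `…PolymerMayerGas.exists_localized_log_gas` (the last Mayer step on `tgeometry 3 N`):
after this, LINE g24-3's cone reads ⟨BAL-GAS∘⟩ → ⟨POLYᵃ∘⟩ → ⟨POLYᵗ∘⟩ → ⟨POLYⁿ∘⟩ → ⟨POLY∘⟩ → ⟨S2β⟩ with every arrow a `Theorems/` theorem.
[cite: Balaban1988RG2Cluster, (2.11)-(2.13) p.14 and (2.38)-(2.41) pp.20-21; Balaban1987RG1, (0.23)-(0.25) p.257; Balaban1989LargeFieldII, (1.98)-(1.100) p.390] -/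
theorem polymerAnalyticCan_of_balabanGas
    (hG : ∀ (L : ℕ), ∃ pS : ℝ, ∀ (b₀ p₀ : ℝ), 0 < b₀ → pS ≤ p₀ → 0 < p₀ → ∃ ε₁ : ℝ, 0 < ε₁ ∧ ∀ (ε₀ : ℝ), 0 < ε₀ → ε₀ ≤ ε₁ →
      ∃ γ₁ : ℝ, 0 < γ₁ ∧ ∃ (M : ℕ) (_ : NeZero M), ∃ κ : ℝ, 0 < κ ∧ 2 * kappa₀ (4 * 2 ^ 3) (2 * 3) ≤ κ ∧
        ∀ (F : T3Family) (γ : ℝ), F.L = L → 0 < γ → γ ≤ γ₁ →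
        ∃ (A Bs Rdec : ℝ) (R : ℕ → ℝ), 0 ≤ A ∧ 0 ≤ Bs ∧ κ + 2 * kappa₀ (4 * 2 ^ 3) (2 * 3) + 2 ≤ Rdec ∧
          A * Real.exp (5 * κ + 1) * K₀ (4 * 2 ^ 3) (2 * 3) * (2 * (3 : ℝ) + 1) * (4 * 2 ^ 3) ≤ 1 ∧
          (∀ J, 1 < R J) ∧ (∀ a : ℕ, Tendsto (fun J : ℕ => ((J : ℝ) + 1) ^ a * (R J)⁻¹) atTop (𝓝 0)) ∧
          ∀ (ν : ℕ → (j : ℕ) → Measure (GaugeField (F.P j) 0 (Matrix.specialUnitaryGroup (Fin 2) ℂ))),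
            (∀ K, ν K K = T4GenFunBounds.gibbsMeasure (F.P K) ((F.scheme ℰp γ).β K)) →
            (∀ K j, j < K → ν K j = Measure.map (descend F ℰp j) (ν K (j + 1))) →
            ∀ (J K : ℕ) (hJK : J ≤ K) (ρ : GaugeField (F.P J) 0 (Matrix.specialUnitaryGroup (Fin 2) ℂ) → ℝ),
              (∀ U, PlaqSmall (θBal F.L γ b₀ p₀ J) U → 0 < ρ U) →
              ν K J = (fieldMeasure _ _ _).withDensity (fun U => ENNReal.ofReal (ρ U)) →
              ContinuousOn ρ {U | PlaqSmall (θBal F.L γ b₀ p₀ J) U} →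
              ∃ (N : ℕ) (_ : NeZero N) (e : Site (F.P J) 0 ≃ TPt 3 (N * M)),
                (∀ x y : Site (F.P J) 0, (x.tdist y : ℝ) = pl1 (e x - e y)) ∧
                ∃ (c₀ : ℝ) (Sm : Finset (TPt 3 N) → GaugeField (F.P J) 0 (Matrix.specialUnitaryGroup (Fin 2) ℂ) → ℝ) (act : TDom 3 N → GaugeField (F.P J) 0 (Matrix.specialUnitaryGroup (Fin 2) ℂ) → ℝ),
                  (∀ (Y : Finset (TPt 3 N)) (U V : GaugeField (F.P J) 0 (Matrix.specialUnitaryGroup (Fin 2) ℂ)),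
                      (∀ b : PBond (F.P J) 0, tcubeOf N M (e b.src) ∈ Y → U b = V b) → Sm Y U = Sm Y V) ∧
                  (∀ Y : Finset (TPt 3 N), ¬ TFaceConnected Y → ∀ U : GaugeField (F.P J) 0 (Matrix.specialUnitaryGroup (Fin 2) ℂ), Sm Y U = 0) ∧
                  (∀ (b : PBond (F.P J) 0) (U V : GaugeField (F.P J) 0 (Matrix.specialUnitaryGroup (Fin 2) ℂ)),
                      PlaqSmall (θBal F.L γ b₀ p₀ J) U → PlaqSmall (θBal F.L γ b₀ p₀ J) V → (∀ e', e' ≠ b → U e' = V e') → ∀ Y : Finset (TPt 3 N),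
                      ∃ g : ℂ → ℂ, DifferentiableOn ℂ g (Metric.ball 0 (R J)) ∧
                        (∀ z ∈ Metric.ball (0 : ℂ) (R J), ‖g z‖ ≤ Bs * Real.exp (-κ * torusTreeLen Y)) ∧
                        g 0 = (Sm Y U : ℂ) ∧ g 1 = (Sm Y V : ℂ)) ∧
                  (∀ (Z : TDom 3 N) (U V : GaugeField (F.P J) 0 (Matrix.specialUnitaryGroup (Fin 2) ℂ)),
                      (∀ b : PBond (F.P J) 0, tcubeOf N M (e b.src) ∈ Z.1 → U b = V b) → act Z U = act Z V) ∧
                  (∀ (Z : TDom 3 N) (U : GaugeField (F.P J) 0 (Matrix.specialUnitaryGroup (Fin 2) ℂ)), PlaqSmall (θBal F.L γ b₀ p₀ J) U →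
                      |act Z U| ≤ A * Real.exp (-(Rdec * torusTreeLen Z.1))) ∧
                  (∀ (b : PBond (F.P J) 0) (U V : GaugeField (F.P J) 0 (Matrix.specialUnitaryGroup (Fin 2) ℂ)),
                      PlaqSmall (θBal F.L γ b₀ p₀ J) U → PlaqSmall (θBal F.L γ b₀ p₀ J) V → (∀ e', e' ≠ b → U e' = V e') →
                      ∃ k : TDom 3 N → ℂ → ℂ, (∀ Z, DifferentiableOn ℂ (k Z) (Metric.ball 0 (R J))) ∧
                        (∀ Z, ∀ z ∈ Metric.ball (0 : ℂ) (R J), ‖k Z z‖ ≤ A * Real.exp (-(Rdec * torusTreeLen Z.1))) ∧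
                        (∀ Z, k Z 0 = (act Z U : ℂ)) ∧ (∀ Z, k Z 1 = (act Z V : ℂ))) ∧
                  (∀ U : GaugeField (F.P J) 0 (Matrix.specialUnitaryGroup (Fin 2) ℂ), PlaqSmall (θBal F.L γ b₀ p₀ J) U →
                      0 < (polymerPartitionFunction TTouch (fun Z : TDom 3 N => (act Z U : ℂ)) Finset.univ).re ∧
                      Real.log (ρ U) + (F.scheme ℰp γ).β K * minActionRegPr F J K hJK ε₀ U =
                        c₀ + (∑ Y : Finset (TPt 3 N), Sm Y U) +
                          Real.log (polymerPartitionFunction TTouch (fun Z : TDom 3 N => (act Z U : ℂ)) Finset.univ).re)) :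
    ∀ (L : ℕ), ∃ pS : ℝ, ∀ (b₀ p₀ : ℝ), 0 < b₀ → pS ≤ p₀ → 0 < p₀ → ∃ ε₁ : ℝ, 0 < ε₁ ∧ ∀ (ε₀ : ℝ), 0 < ε₀ → ε₀ ≤ ε₁ →
      ∃ γ₁ : ℝ, 0 < γ₁ ∧ ∃ (M : ℕ) (_ : NeZero M), ∃ κ : ℝ, 0 < κ ∧ 2 * kappa₀ (4 * 2 ^ 3) (2 * 3) ≤ κ ∧
        ∀ (F : T3Family) (γ : ℝ), F.L = L → 0 < γ → γ ≤ γ₁ →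
        ∃ (B : ℝ) (R : ℕ → ℝ), 0 ≤ B ∧ (∀ J, 1 < R J) ∧ (∀ a : ℕ, Tendsto (fun J : ℕ => ((J : ℝ) + 1) ^ a * (R J)⁻¹) atTop (𝓝 0)) ∧
          ∀ (ν : ℕ → (j : ℕ) → Measure (GaugeField (F.P j) 0 (Matrix.specialUnitaryGroup (Fin 2) ℂ))),
            (∀ K, ν K K = T4GenFunBounds.gibbsMeasure (F.P K) ((F.scheme ℰp γ).β K)) →
            (∀ K j, j < K → ν K j = Measure.map (descend F ℰp j) (ν K (j + 1))) →
            ∀ (J K : ℕ) (hJK : J ≤ K) (ρ : GaugeField (F.P J) 0 (Matrix.specialUnitaryGroup (Fin 2) ℂ) → ℝ),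
              (∀ U, PlaqSmall (θBal F.L γ b₀ p₀ J) U → 0 < ρ U) →
              ν K J = (fieldMeasure _ _ _).withDensity (fun U => ENNReal.ofReal (ρ U)) →
              ContinuousOn ρ {U | PlaqSmall (θBal F.L γ b₀ p₀ J) U} →
              ∃ (N : ℕ) (_ : NeZero N) (e : Site (F.P J) 0 ≃ TPt 3 (N * M)),
                (∀ x y : Site (F.P J) 0, (x.tdist y : ℝ) = pl1 (e x - e y)) ∧
                ∃ (c₀ : ℝ) (T : Finset (TPt 3 N) → GaugeField (F.P J) 0 (Matrix.specialUnitaryGroup (Fin 2) ℂ) → ℝ),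
                  (∀ (Y : Finset (TPt 3 N)) (U V : GaugeField (F.P J) 0 (Matrix.specialUnitaryGroup (Fin 2) ℂ)),
                      (∀ b : PBond (F.P J) 0, tcubeOf N M (e b.src) ∈ Y → U b = V b) → T Y U = T Y V) ∧
                  (∀ Y : Finset (TPt 3 N), ¬ TFaceConnected Y → ∀ U : GaugeField (F.P J) 0 (Matrix.specialUnitaryGroup (Fin 2) ℂ), T Y U = 0) ∧
                  (∀ (Y : Finset (TPt 3 N)) (b : PBond (F.P J) 0) (U V : GaugeField (F.P J) 0 (Matrix.specialUnitaryGroup (Fin 2) ℂ)),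
                      PlaqSmall (θBal F.L γ b₀ p₀ J) U → PlaqSmall (θBal F.L γ b₀ p₀ J) V → (∀ e, e ≠ b → U e = V e) →
                      ∃ g : ℂ → ℂ, DifferentiableOn ℂ g (Metric.ball 0 (R J)) ∧
                        (∀ z ∈ Metric.ball (0 : ℂ) (R J), ‖g z‖ ≤ B * Real.exp (-κ * torusTreeLen Y)) ∧
                        g 0 = (T Y U : ℂ) ∧ g 1 = (T Y V : ℂ)) ∧
                  (∀ U : GaugeField (F.P J) 0 (Matrix.specialUnitaryGroup (Fin 2) ℂ), PlaqSmall (θBal F.L γ b₀ p₀ J) U →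
                      Real.log (ρ U) + (F.scheme ℰp γ).β K * minActionRegPr F J K hJK ε₀ U = c₀ + ∑ Y, T Y U) :=
  polymerAnalyticCan_of_balabanGas_of_mayer
    (fun _ _ _ _ q S ρ _ _ _ _ hA hr₁ hrate hsmall hbound hloc hana =>
      FluctuationComparisonRegPrIntLPolymerMayerGas.exists_localized_log_gas q S ρ hA hr₁ hrate hsmall hbound hloc hana) hG

end Summit.QuantumFields.YangMills.Theorems.FluctuationComparisonRegPrIntLPolymerGasKnit

end
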